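import Summits.ValiantsHypothesis.ValiantsHypothesis.Theses.SymmetroidDescartes
import Summits.ValiantsHypothesis.ValiantsHypothesis.Theorems.SymmetroidDescartesRolleToDescartes
import Summits.ValiantsHypothesis.ValiantsHypothesis.Theorems.SymmetroidDescartesThetaPencilWitnessPencil
import Summits.ValiantsHypothesis.ValiantsHypothesis.Theorems.SymmetroidDescartesDerivedPencilRolleWalkSign
import Summits.ValiantsHypothesis.ValiantsHypothesis.Theorems.SymmetroidDescartesDerivedPencilRolleWalkDet
import Summits.ValiantsHypothesis.ValiantsHypothesis.Theorems.SymmetroidDescartesDerivedPencilRolleStaircase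

/-!
# Route SymmetroidDescartes — the crux `DerivedPencilRolle` (stmt-ValiantsHypothesis-18500) is FALSE

`theorem not_DerivedPencilRolle : ¬ DerivedPencilRolle`.

Why.  The supports `RolleToDescartes` (18503), `ThetaPencilWitness` (18502) and `Assembly` (18504) are
tree theorems, so `DerivedPencilRolle → ValiantsHypothesis` holds in the tree; the matrix-Rolle step is
in fact false.  The tree lemma `alternations_le_of_derivedPencilRolle`
(`Theorems/SymmetroidDescartesRolleToDescartes.lean`) turns `DerivedPencilRolle` into a bound
`K · C^K · (m+K)^a` on the number of sign alternations of the determinant of EVERY symmetric `K`-term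
lacunary pencil of size `m` (singular coefficients and repeated exponents allowed).  Against it we put
the STAIRCASE FAMILY (`DPR.stub_stair`, files `…StairDefs/StairGadget/StairCells/StairLaw/Staircase`):
layered graphs with `(2^L−1)(n+1)` layers on `2^L n · 2` vertices and `L+1` exponent classes whose path
polynomial has a unique dominant walk of sign `(-1)^j` at `n^L` increasing test points (a mirror-free
variant of the Carstensen 1983 / Mulmuley–Shah 2001 parametric-shortest-path lower bound with O(L)
slope classes); dominance (`DPR.stub_walkSign`), the path determinant `det(I − Z₀ − W·u vᵀ) = 1 − W·P`
(`DPR.stub_walkDet`) and the tree's GKKP symmetrisation (`hasSymmAffineDetRepr_of_hasDetRepr`,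
`exists_symm_pencil_eval`) give symmetric pencils with `K = L+2` terms, size `4m₀³+7` and `n^L − 1`
alternations, which beat the bound for `L = 6a+1` and a suitable even `n` (`DPR.stub_arith`).

References: Carstensen (1983), Mulmuley–Shah, *A lower bound for the shortest path problem*, JCSS 63
(2001); Grenet–Kaltofen–Koiran–Portier (2011) for the symmetrisation (tree theorem).
-/

-- single-conjunct layout: Sub = Summit, duplicated namespace component intended
set_option linter.dupNamespace false

namespace Summit.ValiantsHypothesis.ValiantsHypothesis.Theorems.SymmetroidDescartes.DPR

open scoped BigOperators
open Summit.ValiantsHypothesis.ValiantsHypothesis.Theses.SymmetroidDescartes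

/-! ### Composition -/

/-- From a unique-minimal-walk family to a SYMMETRIC lacunary pencil whose determinant alternates in
sign along a strictly increasing sequence of positive test points (dominance + path determinant +
GKKP symmetrisation from the tree). [folklore] -/
theorem exists_symm_pencil_alternating {V : Type} [Fintype V] [DecidableEq V] {K N : ℕ}
    (d : Fin K → ℕ) (g : List (WLayer V K)) (v₀ : V) (lam : Fin (N + 1) → ℤ)
    (wstar : Fin (N + 1) → List V) (c : Fin (N + 1) → ℤ) (hlam : StrictMono lam)
    (hc : ∀ j, walkCost d (lam j) g v₀ (wstar j) = (c j : WithTop ℤ))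
    (hgap : ∀ j (w : List V), w ≠ wstar j → (((c j + 1 : ℤ)) : WithTop ℤ) ≤ walkCost d (lam j) g v₀ w)
    (hsign : ∀ j, walkSign g v₀ (wstar j) = (-1) ^ (j : ℕ)) :
    ∃ (S : Fin (K + 1) → Matrix (Fin (4 * ((g.length + 1) * Fintype.card V) ^ 3 + 7))
        (Fin (4 * ((g.length + 1) * Fintype.card V) ^ 3 + 7)) ℝ) (e : Fin (K + 1) → ℕ),
      (∀ l, (S l).IsSymm) ∧ ∃ τ : Fin (N + 1) → ℝ, StrictMono τ ∧ (∀ j, 0 < τ j) ∧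
        ∀ j : Fin N,
          ((∑ l, (Polynomial.X : Polynomial ℝ) ^ e l • (S l).map Polynomial.C).det).eval (τ j.castSucc) *
          ((∑ l, (Polynomial.X : Polynomial ℝ) ^ e l • (S l).map Polynomial.C).det).eval (τ j.succ) < 0 := by
  classical
  -- the vertex set is nonempty (it contains `v₀`), so `|V| ≥ 1`
  have hcard : (1 : ℝ) ≤ Fintype.card V := by
    exact_mod_cast Fintype.card_pos_iff.2 ⟨v₀⟩
  -- the small base
  set η : ℝ := 1 / (2 * (Fintype.card V : ℝ) ^ g.length) with hη
  have hden : 0 < 2 * (Fintype.card V : ℝ) ^ g.length := by positivity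
  have hη0 : 0 < η := by rw [hη]; positivity
  have hη1 : η < 1 := by
    rw [hη, div_lt_one hden]
    have : (1 : ℝ) ≤ (Fintype.card V : ℝ) ^ g.length := one_le_pow₀ hcard
    linarith
  have hηle : η * (2 * (Fintype.card V : ℝ) ^ g.length) ≤ 1 := by
    rw [hη, div_mul_cancel₀ _ hden.ne']
  -- path sums at the test points: sign `(-1)^j`, size at least `η^c/2`
  set P : Fin (N + 1) → ℝ := fun j => pathSum d η (η ^ (-lam j)) g v₀ with hP
  have hPest : ∀ j, |P j - ((-1 : ℝ) ^ (j : ℕ)) * η ^ c j| ≤ η ^ c j / 2 := by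
    intro j
    have h := stub_walkSign V K d g v₀ (lam j) (wstar j) (c j) (hc j) (hgap j) η hη0 hηle
    simpa [hP, hsign j] using h
  have hpow : ∀ j, 0 < η ^ c j := fun j => zpow_pos hη0 _
  -- `(-1)^j * P j ≥ η^c/2 > 0`
  have hPsgn : ∀ j, η ^ c j / 2 ≤ (-1 : ℝ) ^ (j : ℕ) * P j := by
    intro j
    have h := hPest j
    rw [abs_le] at h
    rcases neg_one_pow_eq_or ℝ (j : ℕ) with h1 | h1 <;> rw [h1] at h ⊢ <;>
      [linarith [h.1]; linarith [h.2]]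
  have hPne : ∀ j, P j ≠ 0 := by
    intro j h0
    have := hPsgn j
    rw [h0, mul_zero] at this
    linarith [hpow j]
  -- the closing weight
  set W : ℝ := ∑ j, 2 / |P j| with hW
  have hWj : ∀ j, 2 ≤ W * |P j| := by
    intro j
    have hj : 2 / |P j| ≤ W := by
      rw [hW]
      exact Finset.single_le_sum (f := fun j => 2 / |P j|) (fun i _ => by positivity)
        (Finset.mem_univ j)
    calc (2 : ℝ) = 2 / |P j| * |P j| := by field_simp [abs_ne_zero.2 (hPne j)]
      _ ≤ W * |P j| := by gcongr
  -- the affine matrix with determinant `1 - W · pathSum`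
  obtain ⟨A, hAdeg, hAdet⟩ := stub_walkDet V K d g v₀ η W
  -- symmetrise (GKKP, tree) and restrict to the monomial curve (tree)
  have hrepr : Literature.Computability.AlgebraicComplexity.HasDetRepr A.det
      ((g.length + 1) * Fintype.card V) := ⟨A, hAdeg, rfl⟩
  obtain ⟨B, hBsymm, hBdeg, hBdet⟩ :=
    hasSymmAffineDetRepr_of_hasDetRepr (k := ℝ) (by norm_num) hrepr
  obtain ⟨S, e, hSsymm, hSeval⟩ := exists_symm_pencil_eval B hBdeg hBsymm d
  refine ⟨S, e, hSsymm, fun j => η ^ (-lam j), ?_, fun j => zpow_pos hη0 _, fun j => ?_⟩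
  · exact fun i j hij => zpow_right_strictAnti₀ hη0 hη1 (neg_lt_neg (hlam hij))
  · -- `det = 1 - W · P` at both test points, with signs `-(-1)^j` and `(-1)^j`
    have hdet : ∀ i : Fin (N + 1),
        ((∑ l, (Polynomial.X : Polynomial ℝ) ^ e l • (S l).map Polynomial.C).det).eval (η ^ (-lam i))
          = 1 - W * P i := by
      intro i
      rw [hSeval, hBdet, RingHom.map_det, RingHom.mapMatrix_apply, hAdet]
    rw [hdet j.castSucc, hdet j.succ]
    have key : ∀ i : Fin (N + 1), (-1 : ℝ) ^ (i : ℕ) * (1 - W * P i) ≤ -1 := by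
      intro i
      have h1 := hPsgn i
      have h2 := hWj i
      have h3 := hpow i
      rcases neg_one_pow_eq_or ℝ (i : ℕ) with h | h <;> rw [h] at h1 ⊢
      · have hPpos : 0 < P i := by linarith
        rw [abs_of_pos hPpos] at h2
        linarith
      · have hPneg : P i < 0 := by linarith
        rw [abs_of_neg hPneg] at h2
        linarith
    have k1 := key j.castSucc
    have k2 := key j.succ
    simp only [Fin.val_castSucc, Fin.val_succ, pow_succ] at k1 k2
    rcases neg_one_pow_eq_or ℝ (j : ℕ) with h | h <;> rw [h] at k1 k2 <;> nlinarith

end Summit.ValiantsHypothesis.ValiantsHypothesis.Theorems.SymmetroidDescartes.DPR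

namespace Summit.ValiantsHypothesis.ValiantsHypothesis.Theorems.SymmetroidDescartes

open Summit.ValiantsHypothesis.ValiantsHypothesis.Theses.SymmetroidDescartes

/-- **The crux `DerivedPencilRolle` (stmt-ValiantsHypothesis-18500) is false.**  By the tree lemma
`alternations_le_of_derivedPencilRolle`, the inductive matrix-Rolle step would bound the number of sign
alternations of the determinant of EVERY symmetric `K`-term lacunary pencil of size `m` by
`K · C^K · (m+K)^a`; the staircase family (`DPR.stub_stair`), read through dominance, the path
determinant and GKKP symmetrisation (`DPR.exists_symm_pencil_alternating`), gives symmetric pencils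
with `K = L + 2` terms, size `4 m₀³ + 7` (`m₀` polynomial in `n`) and `n^L − 1` alternations, which for
`L = 6a + 1` and `n` large (`DPR.stub_arith`) exceeds that bound. [folklore] -/
theorem not_DerivedPencilRolle : ¬ DerivedPencilRolle := by
  intro h
  obtain ⟨C, a, _, hbound⟩ := alternations_le_of_derivedPencilRolle h
  obtain ⟨n, hn, he, harith⟩ := DPR.stub_arith C a
  have hL1 : 1 ≤ 6 * a + 1 := by omega
  have hnL : 1 ≤ n ^ (6 * a + 1) := Nat.one_le_pow _ _ (by omega)
  obtain ⟨g, d, v₀, lam, wstar, c, hlen, hlam, hc, hgap, hsign⟩ :=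
    DPR.stub_stair n (6 * a + 1) (n ^ (6 * a + 1) - 1) hn he hL1 (Nat.sub_add_cancel hnL)
  obtain ⟨S, e, hS, τ, hτ, hpos, halt⟩ :=
    DPR.exists_symm_pencil_alternating d g v₀ lam wstar c hlam hc hgap hsign
  have hN := hbound (6 * a + 1 + 1 + 1) _ S e hS (n ^ (6 * a + 1) - 1) τ hτ hpos halt
  rw [hlen, Fintype.card_prod, Fintype.card_fin, Fintype.card_bool] at hN
  have hK : 6 * a + 1 + 1 + 1 = 6 * a + 3 := by ring
  rw [hK] at hN
  exact absurd harith (not_lt.2 hN)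

end Summit.ValiantsHypothesis.ValiantsHypothesis.Theorems.SymmetroidDescartes
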